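/-
Copyright: statement-level skeleton of a published paper (lit-balaban cell, Phase-2 proof seat p25, gen 18). No proof
claims beyond what the kernel checks below.
-/
import Literature.MathematicalPhysics.QuantumFieldTheory.BalabanImbrieJaffe1984to88.BIJ88WalkRunEnv311

/-!
# `BalabanImbrieJaffe1984to88.BIJ88WalkExpansion311` — T. Bałaban, J. Imbrie, A. Jaffe, *Effective action and
cluster properties of the abelian Higgs model*, Commun. Math. Phys. **114** (1988) 257–315 [BalabanImbrieJaffe1988],
§5.14 p. 311–312 [PDF 55–56] *"After sufficiently many integrations by parts, all components of X will be complete.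
We break up the observable according to the connected components of X. The components containing contractions to
χ′_{Λ^{(k)}}, terms from the random walk expansions, or at least m̄+1 interactions are called remainder components
{X_r}. The other components are called constant components {X_c} …"* — **THE COMPONENT EXPANSION WITH THE COVARIANCE
SPLIT AND ITS BOOKKEEPING** (p25 gen 18, on `BIJ88WalkRun311.run`): the observables are taken up one at a time (least
untouched index first), each runs until its component is complete; a CONSTANT component is booked as a block `X_c` of
the term, a remainder component — `χ′`, `m̄+1` vertices, OR A RANDOM-WALK TERM — is set aside and stays available for
later contractions.  Soundness of the bookkeeping (`expand_sound`) as in gen 16.  The geometry of the terms (every block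
and remainder component `R`-connected) is the sibling `BIJ88WalkExpansionGeo311`, the analytic identity (nothing is
lost, given `Σ_p Cov p = A⁻¹`) the sibling `BIJ88WalkIdentity311`.

statement-level skeleton of published theorems with citation tags; proofs where landed; nothing here is a claim
about the Yang–Mills mass gap

PDF held: `paper:balaban1988-cmp114-bij-abelian-higgs-effective-action` (journal page = PDF page + 256); p. 311–312 =
PDF 55–56 (`p0055.txt` L23–38, `p0056.txt` L1–9 re-read this session, 2026-08-22).

CITATION HEADER (lean-in-tree rule).  lit-balaban cell (HOME `run/shared/lean/pub/lit-balaban/`), Phase 2, seat p25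
gen 18; row **C2.Claim@312** of `HOME/lit-balaban-r16/ROWS-C2-part2.md` (owner r16, referee ref-5; head
`BIJ88Sect5StatementsPart4.Ineq312` untouched).  USED BY NAME, nothing restated: `BIJ88WalkRun311.{WGrp, WOut, run,
pristine}`, `BIJ88WalkRunEnv311.{run_rest_subset, run_done_le, run_complete, run_const}` (this seat and generation),
`BIJ88LabelledRun311.{mbind, mem_mbind}` (p25 gen 16).

## What is proved (0 `sorry`, standard axioms, no new `Prop` facts; definitions with bodies: `WTerm`, `oact`,
`WTerm.addConst`, `expand`)

* §1 `WTerm`, `oact`, `WTerm.addConst`, **`expand`** (well-founded on the number of untouched observables;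
  `expand_of_not_nonempty`, `expand_of_nonempty`), **`expand_sound`** (every block is a constant component — no
  pending leg, no `χ′`, fewer than `M` vertices, no random-walk term; every set-aside component is complete; a state
  with a set-aside component yields terms with set-aside components), `expand_sound_init`.
HONEST SCOPE: as in `BIJ88WalkRun311` — contraction-graph components, pieces and trigger are data, fixed order of
events; bookkeeping only, no analysis.  NOT summit progress; NOT continuum; NOT Clay.  Imports `BIJ88WalkRunEnv311`
only; modifies nothing.
-/

noncomputable section

namespace Literature.MathematicalPhysics.QuantumFieldTheory.BalabanImbrieJaffe1984to88.BIJ88WalkExpansion311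

open Classical Matrix Finset
open scoped BigOperators
open BIJ88LabelledRun311 (mbind mem_mbind)
open BIJ88WalkRun311 BIJ88WalkRunEnv311

variable {S : Type} [Fintype S] {ι : Type} [Fintype ι] {κ : Type} [LinearOrder κ] {P : Type} [Fintype P]

/-! ## §1  Terms and the expansion -/

/-- **A term of the component expansion with the covariance split**: coefficient, `χ′`-directions (earliest first),
number of vertices differentiated down, the constant components (blocks `X_c`, with their records) and the remainder
components set aside (`X_r`, with their records and pending legs). [cite: BalabanImbrieJaffe1988, §5.14 p.311–312] -/
structure WTerm (S κ ι P : Type) where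
  /-- product of all contraction weights -/
  coef : ℝ
  /-- directions of the contractions to `χ′`, earliest first -/
  dirs : List (S → ℝ)
  /-- interaction vertices differentiated down -/
  nv : ℕ
  /-- the constant components `{X_c}` -/
  consts : Multiset (WGrp S κ ι P)
  /-- the complete components set aside at the end (the remainder components `{X_r}`, and whatever was passed in) -/
  groups : Multiset (WGrp S κ ι P)

/-- An outcome acting on a later term: weights multiply, directions and vertex counts accumulate.
[cite: BalabanImbrieJaffe1988, §5.14 p.311] -/
@[simps] def oact (o : WOut S κ ι P) (t : WTerm S κ ι P) : WTerm S κ ι P :=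
  ⟨o.a * t.coef, o.D ++ t.dirs, o.dv + t.nv, t.consts, t.groups⟩

/-- Booking a constant component as a block of the term. [cite: BalabanImbrieJaffe1988, §5.14 p.311–312] -/
@[simps] def WTerm.addConst (g : WGrp S κ ι P) (t : WTerm S κ ι P) : WTerm S κ ι P := { t with consts := g ::ₘ t.consts }

variable (Cov : P → Matrix S S ℝ) (trig : P → Bool) (f : S → ℝ) (c : ι → ℝ) (legs : ι → List (S → ℝ))
  (obs : κ → List (S → ℝ)) (M : ℕ)

/-- **THE COMPONENT EXPANSION WITH THE COVARIANCE SPLIT** (p. 311–312): with complete components `done` set aside and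
observables `rest` untouched — no observable left: the single terminal term; otherwise the least untouched observable
starts a component, which runs until complete (`run`: through every piece, with the random-walk trigger); a CONSTANT
component is booked as a block `X_c` of every resulting term, a remainder component is set aside (available for later
contractions); continue with what is left.  Well-founded on `#rest`. [cite: BalabanImbrieJaffe1988, §5.14 p.311–312] -/
def expand : Multiset (WGrp S κ ι P) → Finset κ → Multiset (WTerm S κ ι P)
  | done, rest =>
    if h : rest.Nonempty then
      mbind (run Cov trig f c legs obs M (pristine obs (rest.min' h)) (rest.erase (rest.min' h)) done) fun o _ho =>
        if o.g.IsConst M then (expand o.done o.rest).map fun t => (oact o t).addConst o.g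
        else (expand (o.g ::ₘ o.done) o.rest).map (oact o)
    else {⟨1, [], 0, 0, done⟩}
  termination_by _ rest => rest.card
  decreasing_by
    all_goals
      exact lt_of_le_of_lt (Finset.card_le_card (run_rest_subset _ _ _ o _ho))
        (Finset.card_erase_lt_of_mem (rest.min'_mem h))

/-- Unfolding: no observable left. [cite: BalabanImbrieJaffe1988, §5.14 p.311] -/
theorem expand_of_not_nonempty {rest : Finset κ} (h : ¬ rest.Nonempty) (done : Multiset (WGrp S κ ι P)) :
    expand Cov trig f c legs obs M done rest = {⟨1, [], 0, 0, done⟩} := by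
  rw [expand, dif_neg h]

/-- Unfolding: the least untouched observable runs. [cite: BalabanImbrieJaffe1988, §5.14 p.311] -/
theorem expand_of_nonempty {rest : Finset κ} (h : rest.Nonempty) (done : Multiset (WGrp S κ ι P)) :
    expand Cov trig f c legs obs M done rest
      = mbind (run Cov trig f c legs obs M (pristine obs (rest.min' h)) (rest.erase (rest.min' h)) done) fun o _ =>
          if o.g.IsConst M then (expand Cov trig f c legs obs M o.done o.rest).map fun t => (oact o t).addConst o.g
          else (expand Cov trig f c legs obs M (o.g ::ₘ o.done) o.rest).map (oact o) := by
  rw [expand, dif_pos h]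

variable {Cov trig f c legs obs M}

/-- **Soundness of the bookkeeping**: every block is a constant component (no pending leg, no `χ′`, fewer than `M`
vertices, no random-walk term), every set-aside component is complete (given that those passed in are), and a state
with a set-aside component yields terms with set-aside components. [cite: BalabanImbrieJaffe1988, §5.14 p.311–312] -/
theorem expand_sound : ∀ (n : ℕ) (done : Multiset (WGrp S κ ι P)) (rest : Finset κ), rest.card < n →
    (∀ h ∈ done, h.complete M = true) → ∀ t ∈ expand Cov trig f c legs obs M done rest,
      (∀ g ∈ t.consts, g.IsConst M) ∧ (∀ g ∈ t.groups, g.complete M = true) ∧ (done ≠ 0 → t.groups ≠ 0)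
  | 0, _, _, hn => fun _ _ _ => absurd hn (Nat.not_lt_zero _)
  | n + 1, done, rest, hn => by
    intro hd t ht
    by_cases h : rest.Nonempty
    · rw [expand_of_nonempty Cov trig f c legs obs M h, mem_mbind] at ht
      obtain ⟨o, ho, ht⟩ := ht
      have hcard : o.rest.card < n := lt_of_lt_of_le (lt_of_le_of_lt (Finset.card_le_card (run_rest_subset _ _ _ o ho))
        (Finset.card_erase_lt_of_mem (rest.min'_mem h))) (Nat.lt_succ_iff.1 hn)
      have hdo : ∀ h ∈ o.done, h.complete M = true :=
        fun h hh => hd h (Multiset.mem_of_le (run_done_le _ _ _ o ho) hh)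
      split_ifs at ht with hg
      · rw [Multiset.mem_map] at ht
        obtain ⟨t', ht', rfl⟩ := ht
        obtain ⟨h1, h2, h3⟩ := expand_sound n o.done o.rest hcard hdo t' ht'
        refine ⟨?_, h2, fun hne => h3 ?_⟩
        · intro g hg'
          simp only [WTerm.addConst_consts, oact_consts, Multiset.mem_cons] at hg'
          rcases hg' with rfl | hg'
          · exact hg
          · exact h1 g hg'
        · rw [(run_const _ _ _ o ho hd hg).2.1]; exact hne
      · rw [Multiset.mem_map] at ht
        obtain ⟨t', ht', rfl⟩ := ht
        have hdo' : ∀ h ∈ o.g ::ₘ o.done, h.complete M = true := fun h hh => by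
          rcases Multiset.mem_cons.1 hh with rfl | hh
          · exact run_complete _ _ _ o ho
          · exact hdo h hh
        obtain ⟨h1, h2, h3⟩ := expand_sound n _ o.rest hcard hdo' t' ht'
        exact ⟨h1, h2, fun _ => h3 (Multiset.cons_ne_zero)⟩
    · rw [expand_of_not_nonempty Cov trig f c legs obs M h, Multiset.mem_singleton] at ht
      subst ht
      exact ⟨fun g hg => absurd hg (Multiset.notMem_zero _), hd, fun hne => hne⟩

/-- **Corollary** (from nothing set aside): the blocks of every term are constant components and its set-aside
components are remainder components (complete, not constant would need the order of booking; we record: complete).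
[cite: BalabanImbrieJaffe1988, §5.14 p.311–312] -/
theorem expand_sound_init (K : Finset κ) :
    ∀ t ∈ expand Cov trig f c legs obs M 0 K, (∀ g ∈ t.consts, g.IsConst M) ∧ ∀ g ∈ t.groups, g.complete M = true :=
  fun t ht =>
    let h := expand_sound (Cov := Cov) (trig := trig) (f := f) (c := c) (legs := legs) (obs := obs) (M := M) _ 0 K
      (Nat.lt_succ_self _) (fun _ hh => absurd hh (Multiset.notMem_zero _)) t ht
    ⟨h.1, h.2.1⟩

end Literature.MathematicalPhysics.QuantumFieldTheory.BalabanImbrieJaffe1984to88.BIJ88WalkExpansion311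

end
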